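import Literature.NumberTheory.EllipticCurves.PAdicLFunction
import Literature.NumberTheory.EllipticCurves.Greenberg1999.TwoTorsionMuInvariant
import Literature.NumberTheory.EllipticCurves.BSDSelmer
import Literature.NumberTheory.EllipticCurves.Tamagawa
import Mathlib.FieldTheory.IsAlgClosed.AlgebraicClosure
import Mathlib.NumberTheory.NumberField.ClassNumber
import HarnessLib

/-!
# The `2`-Selmer rank of an elliptic curve and the `2`-class group of its cubic `2`-torsion field
# (Brumer–Kramer 1977; Yoo–Yu 2022), special case recorded for the rank-zero cell at `p = 2`

Topic `NumberTheory/EllipticCurves`; namespace `Literature.NumberTheory.EllipticCurves`. STATEMENT ONLY (a named fact, D-0014: an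
explicit hypothesis `(hYY : yooYu_selmerTwo_eq_bot_oddClassNumber_cubicTwoTorsionField)` for its users; discharging it = proving
`…_holds`). Filed by the prover seat `bsd-line-att-p5` gen 29 of cell `bsd-f1-sign2` (`--supports` stmt-BirchSwinnertonDyer-22298: it turns
the class-number bit `2 ∤ h(ℚ(β))` of the cubic Chevalley road into the `2`-Selmer condition `Sel₂(W/ℚ) = 0`).

Printed results. For `E/K : y² = F(x)`, `F ∈ 𝓞_K[x]` monic irreducible, `L = K[x]/(F)`, Yoo–Yu (Pacific J. Math. 320 (2022)) prove:
Thm. 1.4 `|M₁| = |C^∞_L[2]| / |C⁺_K[2]|`; Thm. 1.6 «If `E` is lower nice at all finite primes of `K`, then `dim_𝔽₂ Sel₂(E/K) ≥ n`, where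
`n = dim_𝔽₂ C^∞_L[2] − dim_𝔽₂ C⁺_K[2]`. Also, if `E` is upper nice at all finite primes of `K`, then `dim_𝔽₂ Sel₂(E/K) ≤ n + [K:ℚ]`»;
Thm. 1.10 (Brumer–Kramer 1977) «For an odd prime `v`, `E` is nice at `v` if `[E(K_v) : E₀(K_v)]` is odd»; Thm. 1.11 «For an even prime `v`,
`E` is nice at `v` if one of the following holds. (1) `E` has good ordinary reduction at `v`. …»; §1 «if the minimal discriminant of `E/K` is
totally negative then the semi-narrow class group of `L` is equal to the narrow class group of `L`». For a complex cubic `L` (one real place,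
`−1 ∈ 𝓞_Lˣ`) the narrow and the ordinary class groups coincide.

What is recorded here: the reading `K = ℚ` (`C⁺_ℚ = 1`), `E = E_W` for a globally minimal `W/ℚ` in the model `Y² = c_W(X) = X³ + b₂X² +
8b₄X + 16b₆` (`X = 4x`; so `L = ℚ(β)` for `β` a root of the `2`-division cubic `4x³ + b₂x² + 2b₄x + b₆`, and `F` irreducible iff `W` has no
rational `2`-torsion abscissa), good ORDINARY at `2` (nice at `2`), `∏_v c_v` odd (all `c_v` odd at odd `v`: nice there; `c₂ = 1`), `Δ_W < 0`
(semi-narrow = class group), in the special shape `Sel₂(E_W/ℚ) = 0 ⟹ C_L[2] = 0`, i.e. `2 ∤ h(ℚ(β))`.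
-- TODO(general form): `dim_𝔽₂ C_L[2] ≤ dim_𝔽₂ Sel₂(E/ℚ) ≤ dim_𝔽₂ C_L[2] + 1` (both bounds; Li 2019 Thm. 1.1 for squarefree `disc F`;
-- Barrera–Pacetti–Tornaría 2021 Thm. 1.7 over totally real `K` with odd narrow class number).

## References
* H. Yoo, M. Yu, *Bounds for 2-Selmer ranks in terms of seminarrow class groups*, Pacific J. Math. 320 (2022) 193–222, Thm. 1.4, 1.6, 1.10,
  1.11, §1 (arXiv:2005.00194, held). [YooYu2022]
* A. Brumer, K. Kramer, *The rank of elliptic curves*, Duke Math. J. 44 (1977) 715–743, §7. [BrumerKramer1977]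
-/

open scoped NumberField
open Polynomial

namespace Literature.NumberTheory.EllipticCurves

/-- **Yoo–Yu 2022, Thm. 1.6 with Thm. 1.4, Thm. 1.10 (Brumer–Kramer 1977), Thm. 1.11 (1) and §1 — special case `K = ℚ`, `Δ < 0`,
`Sel₂ = 0`.** For `W/ℚ` globally minimal with good ORDINARY reduction at `2`, no rational `2`-torsion abscissa (the `2`-division cubic is
irreducible), `Δ_W < 0` and odd Tamagawa product: if the `2`-Selmer group `Sel₂(E_W/ℚ)` is trivial then the class number of the cubic
`2`-torsion field `ℚ(β)` (`β ∈ ℚ̄` any root of `4x³ + b₂x² + 2b₄x + b₆`) is odd. (From the printed lower bound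
`dim_𝔽₂ C^∞_L[2] ≤ dim_𝔽₂ Sel₂(E/ℚ)` under niceness at every finite prime, with `C^∞_L = C⁺_L = C_L` for the complex cubic `L = ℚ(β)`.)
[cite: YooYu2022, Thm. 1.6 with Thm. 1.4 / 1.10 / 1.11 (1) and §1] -/
def yooYu_selmerTwo_eq_bot_oddClassNumber_cubicTwoTorsionField : Prop :=
  ∀ (W : WeierstrassCurve ℚ) [W.IsElliptic] [W.IsGloballyMinimal], IsOrdinaryAt W 2 →
    (∀ x : ℚ, ¬ Greenberg1999.HasRationalTwoTorsionX W x) → W.Δ < 0 → Odd W.tamagawaProduct → W.selmerGroup 2 = ⊥ →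
    ∀ ⦃β : AlgebraicClosure ℚ⦄, aeval β W.twoTorsionPolynomial.toPoly = 0 →
      ¬ 2 ∣ Nat.card (ClassGroup (𝓞 ↥(IntermediateField.adjoin ℚ ({β} : Set (AlgebraicClosure ℚ)))))

/-- **Yoo–Yu 2022, Thm. 1.6 (BOTH bounds) with Thm. 1.4, Thm. 1.10 (Brumer–Kramer 1977), Thm. 1.11 (1) and §3.1 — the case
`K = ℚ`, `Δ < 0`; the general form announced in the TODO of `yooYu_selmerTwo_eq_bot_oddClassNumber_cubicTwoTorsionField` above.**
Printed (Thm. 1.6): «If `E` is lower nice at all finite primes of `K`, then we have `dim_𝔽₂ Sel₂(E/K) ≥ n`, where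
`n = dim_𝔽₂ C^∞_L[2] − dim_𝔽₂ C⁺_K[2]`. Also, if `E` is upper nice at all finite primes of `K`, then we have
`dim_𝔽₂ Sel₂(E/K) ≤ n + [K:ℚ]`.» (Thm. 1.10: «For an odd prime `v`, `E` is nice at `v` if `[E(K_v) : E₀(K_v)]` is odd. For an
even prime `v`, `E` is nice at `v` if `K_v/ℚ₂` is unramified and `E` has good reduction at `v`»; Thm. 1.11 (1): good ordinary at an
even `v` ⟹ nice; §3.1: «If all the real primes of `K` are ramified then `C^∞_L = C⁺_L`».) Reading recorded here: `K = ℚ`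
(`C⁺_ℚ = 1`, `[K:ℚ] = 1`), `E = E_W` for a globally minimal `W/ℚ` in the model `Y² = c_W(X) = X³ + b₂X² + 8b₄X + 16b₆` (so `L = ℚ(β)`,
`β ∈ ℚ̄` a root of the `2`-division cubic `4x³ + b₂x² + 2b₄x + b₆`, irreducible iff no rational `2`-torsion abscissa), good ORDINARY at `2`,
`∏_v c_v` odd (nice at every finite prime), `Δ_W < 0` (the real prime ramifies in the complex cubic `L`, so `C^∞_L = C⁺_L = C_L`); the
`2`-ranks are written as cardinalities: `#(C_L/C_L²) = #C_L[2] = 2^{rank₂ C_L}` (`C_L² = (powMonoidHom 2).range`, the tree's currency of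
`classGroupPRank`), `#Sel₂ = 2^{dim Sel₂}`, so that the printed `rank₂ C_L ≤ dim_𝔽₂ Sel₂(E_W/ℚ) ≤ rank₂ C_L + 1` reads
**`#(C_L/C_L²) ≤ #Sel₂(E_W/ℚ) ≤ 2 · #(C_L/C_L²)`**. STATEMENT ONLY (named fact; users take `(hYY2 : yooYu_card_selmerTwo_bounds_cubicTwoTorsionField)`).
(Li 2019 Thm. 1.1 is the case `disc F` squarefree; Barrera–Pacetti–Tornaría 2021 Thm. 1.3 the case of odd narrow class number of `K`.)
[cite: YooYu2022, Thm. 1.6 with Thm. 1.4 / 1.10 / 1.11 (1) and §3.1] -/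
def yooYu_card_selmerTwo_bounds_cubicTwoTorsionField : Prop :=
  ∀ (W : WeierstrassCurve ℚ) [W.IsElliptic] [W.IsGloballyMinimal], IsOrdinaryAt W 2 →
    (∀ x : ℚ, ¬ Greenberg1999.HasRationalTwoTorsionX W x) → W.Δ < 0 → Odd W.tamagawaProduct →
    ∀ ⦃β : AlgebraicClosure ℚ⦄, aeval β W.twoTorsionPolynomial.toPoly = 0 →
      Nat.card (ClassGroup (𝓞 ↥(IntermediateField.adjoin ℚ ({β} : Set (AlgebraicClosure ℚ)))) ⧸
            (powMonoidHom 2 : ClassGroup (𝓞 ↥(IntermediateField.adjoin ℚ ({β} : Set (AlgebraicClosure ℚ)))) →* _).range) ≤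
          Nat.card (W.selmerGroup 2) ∧
        Nat.card (W.selmerGroup 2) ≤
          2 * Nat.card (ClassGroup (𝓞 ↥(IntermediateField.adjoin ℚ ({β} : Set (AlgebraicClosure ℚ)))) ⧸
            (powMonoidHom 2 : ClassGroup (𝓞 ↥(IntermediateField.adjoin ℚ ({β} : Set (AlgebraicClosure ℚ)))) →* _).range)

end Literature.NumberTheory.EllipticCurves
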